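import Mathlib
import Literature.RingTheory.CohomologyAnnihilator.Basic
import Literature.RingTheory.CohomologyAnnihilator.Localization
import Summits.ResolutionOfSingularities.ResolutionOfSingularities.Theorems.HomologicalConductorPersistenceVeroneseExponentTwo
import HarnessLib
import HarnessLib.Audit

/-!
# Vocabulary of DECISION D1 / T-HOLD: the Veronese cylinder, its singular-line ideal, `CubicsLevelFive`

Crux `HomologicalConductor.Persistence` (stmt-ResolutionOfSingularities-16484), chain W4.4b, rung L1;
plan-1 ASSIGN v0.9 row «stub-3» (2): «`CubicsLevelFive` Prop DEFINITION file next to idea-2's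
`D1Global` vocabulary (definition only, no proof) so every seat cites one name» — statement of record
fixed by res-L1-w44b-tri-2's MERGE-WORDING (2026-08-27T03:45Z). `[OURS · L1 w44b]` — names for
OUR OWN bench statements about ONE stage of the route's `ca`-tower; NOT statements of the manuscript
under review, and no statement of that manuscript is used; AI-written (weaker than expert review).
The Props below are CANDIDATES (`CubicsLevelFive`, `D1Global`: evidence-level HOLD ×5 in the chain's
census, CHAIN v5 §V5.2; NOT proved here); the only theorems in this file are unfoldings and the
exponent-TWO facts imported from `Theorems/HomologicalConductorPersistenceVeroneseExponentTwo.lean`.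
`CubicsLevelFive` and `D1Global` carry the obligation tag `@[conjecture]` (HarnessLib.Audit.Tags: open named
conjecture stated in our theories — provable / refutable BY NAME, never a vendored fact).

* `veroneseWeight = ![1, 1, 0] : Fin 3 → ZMod 3` — the `μ₃`-weights of `a = X 0`, `b = X 1`,
  `u = X 2`;
* `veroneseCylinder k = k[a³, a²b, ab², b³, u] ⊆ k[a, b, u]` (idea-2's `Algebra.adjoin` form,
  verbatim) — the un-localised normalised `ca`-chart `T₁` of the `A₂ × line` tower (stub-2's
  KILL-CANDIDATE-A2xLine, `O = (4,3,1)`); `mem_veroneseCylinder_iff`: it is the weighted-degree-`0`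
  subalgebra (all characteristics);
* `veroneseCubics k = {a³, a²b, ab², b³}`, `veroneseIdeal k = 𝔪_V · veroneseCylinder k` (the ideal
  of the singular line, generated by the four cubics);
* `CubicsLevelFive k : Prop` — T-HOLD, the statement of record: `𝔪_V · T₁ ⊆ ca⁵(T₁)` GLOBALLY,
  `veroneseIdeal k ≤ ca⁵(veroneseCylinder k)` (idea-1 A4 «C⁺» = idea-2 B3 CLAIM 1 = stub-1 §8.3(γ);
  level `5` is forced by N11 `a³ ∉ ca⁴(T₁)`); `cubicsLevelFive_iff` unfolds it to the four cubics;
* `D1Global k : Prop` — DECISION D1 in idea-2's global form `a³ ∈ ca(veroneseCylinder k)`;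
  `d1Global_of_cubicsLevelFive`; `veroneseIdeal_map_le_of_cubicsLevelFive` (T-HOLD localises to
  `T₁ = R_Q` by [IyengarTakahashi2014, Lemma 2.10(1)]);
* PROVED (imported, all characteristics): `veroneseIdeal_sq_le` : `(𝔪_V R)² ≤ ca⁴(R)` and its
  localised form `veroneseIdeal_map_sq_le` — «exponent TWO at level 4».
-/

-- single-problem summit: the doubled namespace component is forced
set_option linter.dupNamespace false

noncomputable section

universe u

namespace Summit.ResolutionOfSingularities.ResolutionOfSingularities.Theorems.HomologicalConductor.PersistenceVeroneseDefs

open MvPolynomial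
open Literature.RingTheory.CohomologyAnnihilator
open Summit.ResolutionOfSingularities.ResolutionOfSingularities.Theorems.HomologicalConductor.PersistenceVeroneseExponentTwo

/-- [OURS · L1 w44b] The `μ₃(1,1)`-weights on `k[a, b, u]`: `a = X 0` and `b = X 1` have weight `1`,
`u = X 2` has weight `0`, values in `ℤ/3`. -/
def veroneseWeight : Fin 3 → ZMod 3 := ![1, 1, 0]

/-- [OURS · L1 w44b · idea-2's `veroneseCylinder`, verbatim] The Veronese cylinder
`R = k[a,b,u]^{μ₃} = V[u]`, `V = k[a³, a²b, ab², b³] = 1/3(1,1)` (the cone over the twisted cubic),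
as a subalgebra of `k[a,b,u]` (`a = X 0`, `b = X 1`, `u = X 2`); `Spec R = V × 𝔸¹`, singular exactly
along the line `𝔪_V R`. It is stub-2's normalised `ca`-chart `T₁` of the `A₂ × line` tower with
`O = (4,3,1)`, un-localised. NOT a statement of the manuscript. -/
def veroneseCylinder (k : Type u) [Field k] : Subalgebra k (MvPolynomial (Fin 3) k) :=
  Algebra.adjoin k {X 0 ^ 3, X 0 ^ 2 * X 1, X 0 * X 1 ^ 2, X 1 ^ 3, X 2}

/-- [OURS · L1 w44b] The four cubics `a³, a²b, ab², b³` generating `𝔪_V`. -/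
def veroneseCubics (k : Type u) [Field k] : Set (MvPolynomial (Fin 3) k) :=
  {X 0 ^ 3, X 0 ^ 2 * X 1, X 0 * X 1 ^ 2, X 1 ^ 3}

/-- [OURS · L1 w44b] The ideal `𝔪_V · R` of the singular line of the Veronese cylinder
`R = veroneseCylinder k`: generated by (the elements of `R` whose underlying polynomials are) the four
cubics `a³, a²b, ab², b³`. -/
def veroneseIdeal (k : Type u) [Field k] : Ideal (veroneseCylinder k) :=
  Ideal.span (((↑) : veroneseCylinder k → MvPolynomial (Fin 3) k) ⁻¹' veroneseCubics k)

/-- [OURS · L1 w44b · T-HOLD, statement of record (tri-2 MERGE-WORDING); CANDIDATE, not proved]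
`CubicsLevelFive k`: on the Veronese cylinder `T₁ = k[a³,a²b,ab²,b³,u]` the whole singular-line
ideal lies in the level-FIVE cohomology annihilator, `𝔪_V · T₁ ⊆ ca⁵(T₁)` GLOBALLY (hence at
`Q = (𝔪_V, u)` by localisation). Equivalently idea-1's C⁺ / idea-2's B3 CLAIM 1 / stub-1 §8.3(γ):
exponent ONE at level `5 = dim T₁ + 2`; level `4` is refuted by N11 (`a³ ∉ ca⁴(T₁)`), exponent TWO
at level `4` is PROVED (`veroneseIdeal_sq_le`). Evidence of record: HOLD ×5 (CHAIN w44b v5 §V5.2).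
NOT a statement of the manuscript. -/
@[conjecture]
def CubicsLevelFive (k : Type u) [Field k] : Prop :=
  veroneseIdeal k ≤ cohomologyAnnihilatorOfDegree (veroneseCylinder k) 5

/-- `a³ ∈ k[a³, a²b, ab², b³, u]`. [OURS · L1 w44b] -/
theorem cube_mem_veroneseCylinder (k : Type u) [Field k] : (X 0 ^ 3 : MvPolynomial (Fin 3) k) ∈ veroneseCylinder k :=
  Algebra.subset_adjoin (by simp)

/-- [OURS · L1 w44b · idea-2's `D1Global`, verbatim; CANDIDATE, not proved] DECISION D1 (CHAIN w44b
v2 §V2.2) in global graded form: `a³ ∈ ca(V[u])`. HOLD here implies HOLD at `Q = (𝔪_V, u)` (`ca`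
localises, [IyengarTakahashi2014, Lemma 2.10]); implied by `CubicsLevelFive`
(`d1Global_of_cubicsLevelFive`). NOT a statement of the manuscript. -/
@[conjecture]
def D1Global (k : Type u) [Field k] : Prop :=
  (⟨X 0 ^ 3, cube_mem_veroneseCylinder k⟩ : veroneseCylinder k) ∈
    cohomologyAnnihilator (veroneseCylinder k)

/-! ## Unfoldings -/

/-- Unfolding of `veroneseWeight`. [OURS · L1 w44b] -/
theorem veroneseWeight_eq : veroneseWeight = ![1, 1, 0] := rfl

/-- Unfolding of `veroneseCylinder` (idea-2's `Algebra.adjoin` form). [OURS · L1 w44b] -/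
theorem veroneseCylinder_eq (k : Type u) [Field k] : veroneseCylinder k =
    Algebra.adjoin k ({X 0 ^ 3, X 0 ^ 2 * X 1, X 0 * X 1 ^ 2, X 1 ^ 3, X 2} :
      Set (MvPolynomial (Fin 3) k)) := rfl

/-- Unfolding of `veroneseCubics`. [OURS · L1 w44b] -/
theorem veroneseCubics_eq (k : Type u) [Field k] : veroneseCubics k =
    ({X 0 ^ 3, X 0 ^ 2 * X 1, X 0 * X 1 ^ 2, X 1 ^ 3} : Set (MvPolynomial (Fin 3) k)) := rfl

/-- Unfolding of `veroneseIdeal`: the span of the four cubics inside the Veronese cylinder. [OURS · L1 w44b] -/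
theorem veroneseIdeal_eq (k : Type u) [Field k] : veroneseIdeal k =
    Ideal.span (((↑) : veroneseCylinder k → MvPolynomial (Fin 3) k) ⁻¹' veroneseCubics k) := rfl

/-- **The Veronese cylinder is the weighted-degree-`0` subalgebra** of `k[a,b,u]` for the weights
`(1,1,0) mod 3` (all characteristics; `mem_adjoin_veronese_iff` of the exponent-two file).
[OURS · L1 w44b] -/
theorem mem_veroneseCylinder_iff (k : Type u) [Field k] (p : MvPolynomial (Fin 3) k) :
    p ∈ veroneseCylinder k ↔ IsWeightedHomogeneous veroneseWeight p 0 :=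
  mem_adjoin_veronese_iff k p

/-- The four cubics lie in the Veronese cylinder. [OURS · L1 w44b] -/
theorem veroneseCubics_subset (k : Type u) [Field k] : veroneseCubics k ⊆ veroneseCylinder k := by
  rintro c hc
  simp only [veroneseCubics, Set.mem_insert_iff, Set.mem_singleton_iff] at hc
  rcases hc with rfl | rfl | rfl | rfl <;> exact Algebra.subset_adjoin (by simp)

/-- `CubicsLevelFive` unfolded: each of the four cubics `a³, a²b, ab², b³`, as an element of the
Veronese cylinder, lies in `ca⁵`. [OURS · L1 w44b] -/
theorem cubicsLevelFive_iff (k : Type u) [Field k] : CubicsLevelFive k ↔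
    ∀ c (hc : c ∈ veroneseCubics k), (⟨c, veroneseCubics_subset k hc⟩ : veroneseCylinder k) ∈
      cohomologyAnnihilatorOfDegree (veroneseCylinder k) 5 := by
  rw [CubicsLevelFive, veroneseIdeal, Ideal.span_le]
  constructor
  · intro h c hc
    exact h (show (⟨c, _⟩ : veroneseCylinder k) ∈ _ from hc)
  · rintro h ⟨c, hc'⟩ hc
    exact h c hc

/-- T-HOLD implies D1: `ca⁵ ⊆ ca`. [OURS · L1 w44b] -/
theorem d1Global_of_cubicsLevelFive (k : Type u) [Field k] (h : CubicsLevelFive k) : D1Global k :=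
  cohomologyAnnihilatorOfDegree_le 5
    ((cubicsLevelFive_iff k).mp h (X 0 ^ 3) (by simp [veroneseCubics]))

/-- T-HOLD localises: `CubicsLevelFive k` gives `𝔪_V · L ⊆ ca⁵(L)` for every localisation `L` of the
Veronese cylinder, in particular the tower stage `T₁ = R_Q`. [OURS · L1 w44b] -/
theorem veroneseIdeal_map_le_of_cubicsLevelFive (k : Type u) [Field k] (h : CubicsLevelFive k)
    (U : Submonoid (veroneseCylinder k)) (L : Type u) [CommRing L] [Algebra (veroneseCylinder k) L]
    [IsLocalization U L] :
    (veroneseIdeal k).map (algebraMap (veroneseCylinder k) L) ≤ cohomologyAnnihilatorOfDegree L 5 := by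
  haveI : Algebra.FiniteType k (veroneseCylinder k) := by
    rw [← Subalgebra.fg_iff_finiteType, Subalgebra.fg_def]
    exact ⟨_, ((((Set.finite_singleton _).insert _).insert _).insert _).insert _, rfl⟩
  haveI : IsNoetherianRing (veroneseCylinder k) :=
    Algebra.FiniteType.isNoetherianRing k (veroneseCylinder k)
  exact (Ideal.map_mono h).trans (map_cohomologyAnnihilatorOfDegree_le_of_isLocalization U L 5)

/-! ## Exponent two at level four (proved, all characteristics) -/

/-- **`(𝔪_V R)² ⊆ ca⁴(R)`** on the Veronese cylinder `R = k[a³,a²b,ab²,b³,u]`, for every field `k`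
(`veronese_adjoin_sq_le_cohomologyAnnihilatorOfDegree_four`). [OURS · L1 w44b] -/
theorem veroneseIdeal_sq_le (k : Type u) [Field k] :
    veroneseIdeal k ^ 2 ≤ cohomologyAnnihilatorOfDegree (veroneseCylinder k) 4 :=
  veronese_adjoin_sq_le_cohomologyAnnihilatorOfDegree_four k

/-- **`(𝔪_V L)² ⊆ ca⁴(L)`** for every localisation `L` of the Veronese cylinder, in particular the
tower stage `T₁ = R_Q` (`veronese_sq_map_le_cohomologyAnnihilatorOfDegree_four`). [OURS · L1 w44b] -/
theorem veroneseIdeal_map_sq_le (k : Type u) [Field k] (U : Submonoid (veroneseCylinder k)) (L : Type u) [CommRing L]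
    [Algebra (veroneseCylinder k) L] [IsLocalization U L] :
    (veroneseIdeal k).map (algebraMap (veroneseCylinder k) L) ^ 2 ≤
      cohomologyAnnihilatorOfDegree L 4 :=
  veronese_sq_map_le_cohomologyAnnihilatorOfDegree_four k (veroneseCylinder k)
    (mem_veroneseCylinder_iff k) U L

end Summit.ResolutionOfSingularities.ResolutionOfSingularities.Theorems.HomologicalConductor.PersistenceVeroneseDefs

end
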